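import Literature.MathematicalPhysics.QuantumFieldTheory.Balaban1983to89.B3WT223Instance

/-!
# `Balaban1983to89.B3WT224Instance` — T. Bałaban, *(Higgs)₂,₃ quantum fields in a finite volume. III. Renormalization*,
# Commun. Math. Phys. **88** (1983) 411–445 [Balaban1983Higgs3], (2.24) p. 430 and (2.25) p. 431: the first Ward–Takahashi
# identities PROVED for the concrete lattice model = r15's abstract-carrier Props `WTData.Eq224` / `WTData.Eq225` DISCHARGED

statement-level skeleton of published theorems with citation tags; proofs where landed; nothing here is a claim about the Yang–Mills mass gap

PDF held: `paper:balaban1983-higgs-2-3-quantum-fields-finite-volume` (journal page = PDF page + 410); pp. 430–431 read on the ×2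
renders `…/1983-cmp88-higgs23-III/1983-cmp88-higgs23-III-p020-x2.png`, `…-p021-x2.png` (as images; the OCR layer garbles both
displays).

WHAT IS REPRODUCED (kind «model-instance»).  SKELETON rows **B3.Eq2.24** and **B3.Eq2.25** of
`run/shared/lean/pub/lit-balaban/SKELETON.md`, decls of record `B3Sect2StatementsPart2.WTData.Eq224` / `.Eq225` (r15, p239134:
`def … : Prop` over the abstract carrier `WTData`, unproved).  p. 430 [PDF 20], verbatim: *"Taking a first order differential with
respect to λ we get: ∫dφ exp[−½⟨φ,(−Δ^η_A + M²)φ⟩]F(φ)⟨D^η_Aφ, ∂^ηλqφ⟩ = 0. (2.24)"*; p. 431 [PDF 21], verbatim: *"few examples.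
Taking F = 1, A = 0, we get ∫dμ_{C^η_{M²}}(φ)⟨∂^ηφ, ∂^ηλqφ⟩ = 0. (2.25)"*.  THE MODEL (`wtModel`): the `(Higgs)₂,₃` lattice datum of
`…B3WT223Instance` — fields `φ : T^{(j)} → R^N` with Lebesgue `dφ`, `U(A) = exp(qηeA)` (B1 (1.7), `B1Eq17Urep`), background
`A`, weight `exp[−½⟨φ,(−Δ^η_A+M²)φ⟩]`; gauge functions `λ : T^{(j)} → R`; *"gauge-invariant functions of scalar fields"* `F` =
continuous, `F(φ^λ) = F(φ)` for all `λ`, of exponential-linear growth `|F(φ)| ≤ Ke^{κ sup|φ|}` (every gauge-invariant polynomial,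
e.g. the printed `F(φ) = −λ_kΣ_{x∈Δ}η^d:|φ(x)|⁴:`); `gaussA F = ∫dφ e^{−½⟨φ,(−Δ^η_A+M²)φ⟩}F(φ)`; `meanC F = ∫dμ_{C^η_{M²}}F` the
normalized Gaussian mean at `A = 0`; the pairing `⟨D^η_Aφ, ∂^ηλqφ⟩ := Σ_b η^d⟪(D^η_Aφ)(b), (∂^ηλ)(b)·qU(A_b)φ(b₊)⟫` (`pairDA`; the
bond field `∂^ηλ qφ` evaluates `q` on the field at `b₊` transported to `b₋`, at `A = 0` simply `qφ(b₊)`: this is the reading under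
which (2.24) IS the `λ`-derivative of (2.23), `hasDerivAt_quadForm`), and `⟨∂^ηφ, ∂^ηλqφ⟩` (`pairD` = `pairDA` at `A = 0`).
WHAT IS PROVED (kernel): `eq224` — **(2.24)** for every `A`, `λ`, admissible `F`, under `η^d > 0`, `M² > 0` and a charged coupling
`cηe ≠ 0`, BY THE PRINTED ROUTE: `t ↦ ∫dφ e^{−½⟨φ,(−Δ_{A−t∂λ}+M²)φ⟩}F(φ)` is constant ((2.23) = `B3WT223Instance.eq223`) and
differentiable under the integral sign (dominated convergence `hasDerivAt_integral_of_dominated_loc_of_deriv_le` with the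
Gaussian majorant `e^{κ′sup|φ|}e^{−(M²η^d/2)Σ|φ(x)|²}`, §2), with derivative `cηe·∫ e^{…}F⟨D_Aφ,∂λqφ⟩` (`hasDerivAt_weight`); a
constant differentiable family has derivative zero (`B3Sect2StatementsPart2.deriv_eq_zero_of_invariant` BY NAME);
`eq224_holds : Eq224 (wtModel …)` and, *"Taking F = 1, A = 0"*, `eq225_holds : Eq225 (wtModel …)`.
NOT HERE: (2.26)–(2.28) (the A-derivatives and their Wick contractions; RESERVE R11 part 2), free boundary conditions.
Phase-2 RESERVE R11 (part 1) of `PHASE2-TARGETS.md` §G.3; cell `lit-balaban`, seat p39 (gen 2, unit `lit-balaban-p39`),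
HOME `run/shared/lean/pub/lit-balaban/`.  No new `Prop` is introduced; `wtModel` is a definition with body (an instance of r15's
carrier), the other definitions are the printed pairings and a named constant.
-/

noncomputable section

open scoped BigOperators InnerProductSpace

namespace Literature.MathematicalPhysics.QuantumFieldTheory.Balaban1983to89.B3WT224Instance

open _root_.MeasureTheory
open LatticeFieldCalculus B3WT223Instance

variable {P : Params} {j N : ℕ} (C : HiggsLattice.ChargeData N) (η w c M2 : ℝ)

/-! ## §1 The pairings of (2.24)/(2.25) and the `λ`-derivative of the exponent -/

/-- `⟨D^η_A φ, ∂^ηλ qφ⟩ := Σ_b η^d ⟪(D^η_Aφ)(b), (∂^ηλ)(b)·qU(A_b)φ(b₊)⟫` — the pairing of (2.24) (`∂^ηλ = LatticeFieldCalculus.grad c λ`);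
it is `−(2cηe)⁻¹·d/dt ⟨φ, −Δ^η_{A−t∂λ}φ⟩` (`hasDerivAt_quadForm`). [cite: Balaban1983Higgs3, (2.24) p.430] -/
def pairDA (A : VecField P j ℝ) (lam : Site P j → ℝ) (φ : Cfg P j N) : ℝ :=
  ∑ b : PBond P j, w * ⟪covDerivScalar c (C.Urep η) A φ b, (grad c lam b) • C.q (C.U η (A b) (φ b.tgt))⟫_ℝ

/-- `⟨∂^ηφ, ∂^ηλ qφ⟩ := Σ_b η^d ⟪(∂^ηφ)(b), (∂^ηλ)(b)·qφ(b₊)⟫` — the pairing of (2.25) (= `pairDA` at `A = 0`, `pairDA_zero`).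
[cite: Balaban1983Higgs3, (2.25) p.431] -/
def pairD (lam : Site P j → ℝ) (φ : Cfg P j N) : ℝ :=
  ∑ b : PBond P j, w * ⟪grad c φ b, (grad c lam b) • C.q (φ b.tgt)⟫_ℝ

/-- `∂^η(tλ) = t∂^ηλ`. [cite: Balaban1983Higgs3, (2.24) p.430] -/
theorem grad_smul (t : ℝ) (lam : Site P j → ℝ) (b : PBond P j) : grad c (t • lam) b = t * grad c lam b := by
  simp only [grad, Pi.smul_apply, smul_eq_mul]
  ring

/-- `(A − ∂^η(tλ))_b = A_b − t(∂^ηλ)(b)` — the one-parameter family of backgrounds along which (2.23) is differentiated.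
[cite: Balaban1983Higgs3, (2.24) p.430] -/
theorem gaugeShift_smul_apply (t : ℝ) (lam : Site P j → ℝ) (A : VecField P j ℝ) (b : PBond P j) :
    gaugeShift c (t • lam) A b = A b - t * grad c lam b := by
  rw [gaugeShift, grad_smul]

/-- at `t = 0` the background is `A`. [cite: Balaban1983Higgs3, (2.24) p.430] -/
theorem gaugeShift_zero_smul (lam : Site P j → ℝ) (A : VecField P j ℝ) : gaugeShift c ((0 : ℝ) • lam) A = A := by
  funext b
  rw [gaugeShift_smul_apply, zero_mul, sub_zero]

/-- `d/ds U(a₀ − sg)v = −ηeg·qU(a₀ − sg)v` for `U(a) = exp(qηea)` (B1 (1.7)). [cite: Balaban1982Higgs1, (1.7) p.605] -/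
theorem hasDerivAt_U_apply (a₀ g : ℝ) (v : EuclideanSpace ℝ (Fin N)) (t : ℝ) :
    HasDerivAt (fun s : ℝ => C.U η (a₀ - s * g) v) ((-(η * C.e * g)) • C.q (C.U η (a₀ - t * g) v)) t := by
  have hθ : HasDerivAt (fun s : ℝ => η * C.e * (a₀ - s * g)) (-(η * C.e * g)) t := by
    refine ((((hasDerivAt_id t).mul_const g).const_sub a₀).const_mul (η * C.e)).congr_deriv ?_
    ring
  have hexp : HasDerivAt (fun u : ℝ => NormedSpace.exp (u • C.q))
      (C.q * NormedSpace.exp ((η * C.e * (a₀ - t * g)) • C.q)) (η * C.e * (a₀ - t * g)) :=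
    hasDerivAt_exp_smul_const' C.q _
  have hcomp := hexp.scomp t hθ
  have happ := ((ContinuousLinearMap.apply ℝ (EuclideanSpace ℝ (Fin N)) v).hasFDerivAt).comp_hasDerivAt t hcomp
  exact happ

/-- the covariant derivative along the family of backgrounds, unfolded. [cite: Balaban1983Higgs3, (2.24) p.430] -/
theorem covDerivScalar_gaugeShift_smul (lam : Site P j → ℝ) (A : VecField P j ℝ) (φ : Cfg P j N) (b : PBond P j) (s : ℝ) :
    covDerivScalar c (C.Urep η) (gaugeShift c (s • lam) A) φ b = c • (C.U η (A b - s * grad c lam b) (φ b.tgt) - φ b.src) := by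
  simp only [covDerivScalar, HiggsLattice.ChargeData.Urep_apply, gaugeShift_smul_apply]

/-- `d/dt (D^η_{A−t∂λ}φ)(b) = c·(−ηe(∂^ηλ)(b))·qU((A−t∂λ)_b)φ(b₊)`. [cite: Balaban1983Higgs3, (2.24) p.430] -/
theorem hasDerivAt_covDerivScalar (lam : Site P j → ℝ) (A : VecField P j ℝ) (φ : Cfg P j N) (b : PBond P j) (t : ℝ) :
    HasDerivAt (fun s : ℝ => covDerivScalar c (C.Urep η) (gaugeShift c (s • lam) A) φ b)
      (c • ((-(η * C.e * grad c lam b)) • C.q (C.U η (gaugeShift c (t • lam) A b) (φ b.tgt)))) t := by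
  have h := ((hasDerivAt_U_apply C η (A b) (grad c lam b) (φ b.tgt) t).sub_const (φ b.src)).const_smul c
  rw [gaugeShift_smul_apply]
  exact h.congr_of_eventuallyEq (Filter.Eventually.of_forall fun s => covDerivScalar_gaugeShift_smul C η c lam A φ b s)

/-- `d/dt |(D^η_{A−t∂λ}φ)(b)|² = 2⟪(D^η_{A−t∂λ}φ)(b), d/dt (D^η_{A−t∂λ}φ)(b)⟫`. [cite: Balaban1983Higgs3, (2.24) p.430] -/
theorem hasDerivAt_norm_sq_covDerivScalar (lam : Site P j → ℝ) (A : VecField P j ℝ) (φ : Cfg P j N) (b : PBond P j) (t : ℝ) :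
    HasDerivAt (fun s : ℝ => ‖covDerivScalar c (C.Urep η) (gaugeShift c (s • lam) A) φ b‖ ^ 2)
      (2 * ⟪covDerivScalar c (C.Urep η) (gaugeShift c (t • lam) A) φ b,
        c • ((-(η * C.e * grad c lam b)) • C.q (C.U η (gaugeShift c (t • lam) A b) (φ b.tgt)))⟫_ℝ) t :=
  (hasDerivAt_covDerivScalar C η c lam A φ b t).norm_sq

/-- **`d/dt ⟨φ, (−Δ^η_{A−t∂λ} + M²)φ⟩ = −2cηe·⟨D^η_{A−t∂λ}φ, ∂^ηλ qφ⟩`** — the *"first order differential with respect to λ"* behind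
(2.24), computed for the lattice model. [cite: Balaban1983Higgs3, (2.24) p.430] -/
theorem hasDerivAt_quadForm (lam : Site P j → ℝ) (A : VecField P j ℝ) (φ : Cfg P j N) (t : ℝ) :
    HasDerivAt (fun s : ℝ => quadForm C η w c M2 (gaugeShift c (s • lam) A) φ)
      (-(2 * (c * η * C.e)) * pairDA C η w c (gaugeShift c (t • lam) A) lam φ) t := by
  unfold quadForm covLaplaceForm
  have hsum : HasDerivAt (fun s : ℝ => ∑ b : PBond P j, w * ‖covDerivScalar c (C.Urep η) (gaugeShift c (s • lam) A) φ b‖ ^ 2)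
      (∑ b : PBond P j, w * (2 * ⟪covDerivScalar c (C.Urep η) (gaugeShift c (t • lam) A) φ b,
        c • ((-(η * C.e * grad c lam b)) • C.q (C.U η (gaugeShift c (t • lam) A b) (φ b.tgt)))⟫_ℝ)) t :=
    HasDerivAt.fun_sum fun b _ => (hasDerivAt_norm_sq_covDerivScalar C η c lam A φ b t).const_mul w
  refine (hsum.add_const (M2 * massForm w φ)).congr_deriv ?_
  rw [pairDA, Finset.mul_sum]
  refine Finset.sum_congr rfl fun b _ => ?_
  rw [real_inner_smul_right, real_inner_smul_right, real_inner_smul_right]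
  ring

/-- `d/dt exp[−½⟨φ,(−Δ^η_{A−t∂λ}+M²)φ⟩] = cηe·exp[…]·⟨D^η_{A−t∂λ}φ, ∂^ηλqφ⟩`. [cite: Balaban1983Higgs3, (2.24) p.430] -/
theorem hasDerivAt_weight (lam : Site P j → ℝ) (A : VecField P j ℝ) (φ : Cfg P j N) (t : ℝ) :
    HasDerivAt (fun s : ℝ => weight C η w c M2 (gaugeShift c (s • lam) A) φ)
      ((c * η * C.e) * (weight C η w c M2 (gaugeShift c (t • lam) A) φ * pairDA C η w c (gaugeShift c (t • lam) A) lam φ)) t := by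
  unfold weight
  refine (((hasDerivAt_quadForm C η w c M2 lam A φ t).const_mul (-(1 / 2 : ℝ))).exp).congr_deriv ?_
  ring

/-! ## §2 Bounds, continuity, Gaussian integrability on field space -/

/-- `|(D^η_Aφ)(b)| ≤ |c|(|φ(b₊)| + |φ(b₋)|)` (`U` unitary). [cite: Balaban1982Higgs1, (1.7) p.605] -/
theorem norm_covDerivScalar_le (A : VecField P j ℝ) (φ : Cfg P j N) (b : PBond P j) :
    ‖covDerivScalar c (C.Urep η) A φ b‖ ≤ |c| * (‖φ b.tgt‖ + ‖φ b.src‖) := by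
  simp only [covDerivScalar, HiggsLattice.ChargeData.Urep_apply, norm_smul, Real.norm_eq_abs]
  refine mul_le_mul_of_nonneg_left ((norm_sub_le _ _).trans ?_) (abs_nonneg c)
  rw [ContinuousLinearMap.norm_map_of_mem_unitary (C.U_mem_unitary η _)]

/-- the constant `K(λ) = Σ_b |η^d|·2|c|·|(∂^ηλ)(b)|` of the bound `|⟨D^η_Aφ, ∂^ηλqφ⟩| ≤ K(λ)·sup_x|φ(x)|²`, uniform in the background `A`.
[cite: Balaban1983Higgs3, (2.24) p.430] -/
def pairBound (lam : Site P j → ℝ) : ℝ := ∑ b : PBond P j, |w| * (2 * |c| * |grad c lam b|)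

/-- `K(λ) ≥ 0`. [cite: Balaban1983Higgs3, (2.24) p.430] -/
theorem pairBound_nonneg (lam : Site P j → ℝ) : 0 ≤ pairBound w c lam :=
  Finset.sum_nonneg fun _ _ => by positivity

/-- `|⟨D^η_Aφ, ∂^ηλqφ⟩| ≤ K(λ)·sup_x|φ(x)|²`, uniformly in `A` (B1 p. 605: `|q| ≤ 1`, `U` unitary). [cite: Balaban1983Higgs3, (2.24) p.430] -/
theorem abs_pairDA_le (A : VecField P j ℝ) (lam : Site P j → ℝ) (φ : Cfg P j N) :
    |pairDA C η w c A lam φ| ≤ pairBound w c lam * ‖φ‖ ^ 2 := by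
  unfold pairDA pairBound
  rw [Finset.sum_mul]
  refine (Finset.abs_sum_le_sum_abs _ _).trans (Finset.sum_le_sum fun b _ => ?_)
  rw [abs_mul]
  have h1 := abs_real_inner_le_norm (covDerivScalar c (C.Urep η) A φ b) ((grad c lam b) • C.q (C.U η (A b) (φ b.tgt)))
  have h2 := norm_covDerivScalar_le C η c A φ b
  have h3 : ‖(grad c lam b) • C.q (C.U η (A b) (φ b.tgt))‖ ≤ |grad c lam b| * ‖φ‖ := by
    rw [norm_smul, Real.norm_eq_abs]
    refine mul_le_mul_of_nonneg_left ?_ (abs_nonneg _)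
    calc ‖C.q (C.U η (A b) (φ b.tgt))‖ ≤ ‖C.q‖ * ‖C.U η (A b) (φ b.tgt)‖ := C.q.le_opNorm _
      _ ≤ 1 * ‖C.U η (A b) (φ b.tgt)‖ := mul_le_mul_of_nonneg_right C.norm_q_le (norm_nonneg _)
      _ = ‖φ b.tgt‖ := by rw [one_mul, ContinuousLinearMap.norm_map_of_mem_unitary (C.U_mem_unitary η _)]
      _ ≤ ‖φ‖ := norm_le_pi_norm φ b.tgt
  have h4 : ‖φ b.tgt‖ + ‖φ b.src‖ ≤ 2 * ‖φ‖ := by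
    have := norm_le_pi_norm φ b.tgt
    have := norm_le_pi_norm φ b.src
    linarith
  calc |w| * |⟪covDerivScalar c (C.Urep η) A φ b, (grad c lam b) • C.q (C.U η (A b) (φ b.tgt))⟫_ℝ|
      ≤ |w| * ((|c| * (2 * ‖φ‖)) * (|grad c lam b| * ‖φ‖)) := by
        refine mul_le_mul_of_nonneg_left (h1.trans ?_) (abs_nonneg w)
        exact mul_le_mul (h2.trans (mul_le_mul_of_nonneg_left h4 (abs_nonneg c))) h3 (norm_nonneg _) (by positivity)
    _ = |w| * (2 * |c| * |grad c lam b|) * ‖φ‖ ^ 2 := by ring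

/-- `φ ↦ (D^η_Aφ)(b)` is continuous on field space. [cite: Balaban1982Higgs1, (1.7) p.605] -/
theorem continuous_covDerivScalar (A : VecField P j ℝ) (b : PBond P j) :
    Continuous fun φ : Cfg P j N => covDerivScalar c (C.Urep η) A φ b := by
  simp only [covDerivScalar, HiggsLattice.ChargeData.Urep_apply]
  exact (((C.U η (A b)).continuous.comp (continuous_apply b.tgt)).sub (continuous_apply b.src)).const_smul c

/-- `φ ↦ ⟨φ,(−Δ^η_A+M²)φ⟩` is continuous. [cite: Balaban1983Higgs3, (2.23) p.430] -/
theorem continuous_quadForm (A : VecField P j ℝ) : Continuous (quadForm C η w c M2 A : Cfg P j N → ℝ) := by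
  unfold quadForm covLaplaceForm massForm
  refine (continuous_finsetSum _ fun b _ => ?_).add (continuous_const.mul (continuous_finsetSum _ fun x _ => ?_))
  · exact continuous_const.mul ((continuous_covDerivScalar C η c A b).norm.pow 2)
  · exact continuous_const.mul ((continuous_apply x).norm.pow 2)

/-- the Gaussian weight is continuous. [cite: Balaban1983Higgs3, (2.23) p.430] -/
theorem continuous_weight (A : VecField P j ℝ) : Continuous (weight C η w c M2 A : Cfg P j N → ℝ) :=
  (continuous_const.mul (continuous_quadForm C η w c M2 A)).rexp

/-- `φ ↦ ⟨D^η_Aφ, ∂^ηλqφ⟩` is continuous. [cite: Balaban1983Higgs3, (2.24) p.430] -/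
theorem continuous_pairDA (A : VecField P j ℝ) (lam : Site P j → ℝ) : Continuous (pairDA C η w c A lam : Cfg P j N → ℝ) := by
  unfold pairDA
  refine continuous_finsetSum _ fun b _ => continuous_const.mul ?_
  have hU : Continuous fun φ : Cfg P j N => C.q (C.U η (A b) (φ b.tgt)) :=
    C.q.continuous.comp ((C.U η (A b)).continuous.comp (continuous_apply b.tgt))
  have h2 : Continuous fun φ : Cfg P j N => (grad c lam b) • C.q (C.U η (A b) (φ b.tgt)) :=
    (continuous_const_smul (grad c lam b)).comp hU
  exact (continuous_covDerivScalar C η c A b).inner h2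

/-- `sup_x |φ(x)|² ≤ Σ_x |φ(x)|²` (the sup norm of field space against the `ℓ²` sum; helper). [folklore] -/
private theorem sq_norm_le_sum (φ : Cfg P j N) : ‖φ‖ ^ 2 ≤ ∑ x : Site P j, ‖φ x‖ ^ 2 := by
  have hs : 0 ≤ ∑ x : Site P j, ‖φ x‖ ^ 2 := Finset.sum_nonneg fun _ _ => sq_nonneg _
  have h1 : ‖φ‖ ≤ Real.sqrt (∑ x : Site P j, ‖φ x‖ ^ 2) := by
    rw [pi_norm_le_iff_of_nonneg (Real.sqrt_nonneg _)]
    intro x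
    exact Real.le_sqrt_of_sq_le
      (Finset.single_le_sum (f := fun y => ‖φ y‖ ^ 2) (fun _ _ => sq_nonneg _) (Finset.mem_univ x))
  calc ‖φ‖ ^ 2 ≤ Real.sqrt (∑ x : Site P j, ‖φ x‖ ^ 2) ^ 2 := pow_le_pow_left₀ (norm_nonneg _) h1 2
    _ = ∑ x : Site P j, ‖φ x‖ ^ 2 := Real.sq_sqrt hs

/-- **Gaussian integrability on field space** (finiteness of the Gaussian integrals of (2.23)/(2.24) via `weight_le_gauss`):
`∫dφ exp[−aΣ_x|φ(x)|²] < ∞` for `a > 0` (sitewise product; Mathlib `GaussianFourier.integral_rexp_neg_mul_sq_norm`). [cite: Balaban1983Higgs3, (2.24) p.430] -/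
theorem integrable_exp_neg_mul_sum_sq {a : ℝ} (ha : 0 < a) :
    Integrable (fun φ : Cfg P j N => Real.exp (-a * ∑ x : Site P j, ‖φ x‖ ^ 2)) := by
  have h1 : ∀ _x : Site P j, Integrable (fun v : EuclideanSpace ℝ (Fin N) => Real.exp (-a * ‖v‖ ^ 2)) := fun _ =>
    Integrable.of_integral_ne_zero (by
      rw [GaussianFourier.integral_rexp_neg_mul_sq_norm ha]
      exact (Real.rpow_pos_of_pos (div_pos Real.pi_pos ha) _).ne')
  have h2 := Integrable.fintype_prod (f := fun (_ : Site P j) (v : EuclideanSpace ℝ (Fin N)) => Real.exp (-a * ‖v‖ ^ 2)) h1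
  refine h2.congr (Filter.Eventually.of_forall fun φ => ?_)
  simp only [← Real.exp_sum, Finset.mul_sum]

/-- the dominated-convergence majorant of the differentiation behind (2.24) (and its `A`-derivative (2.26)): `∫dφ e^{κ sup|φ|}e^{−aΣ_x|φ(x)|²} < ∞`
for `a > 0` (completing the square, `κs ≤ (a/2)s² + κ²/(2a)`). [cite: Balaban1983Higgs3, (2.24) p.430] -/
theorem integrable_explin_mul_gauss (κ : ℝ) {a : ℝ} (ha : 0 < a) :
    Integrable (fun φ : Cfg P j N => Real.exp (κ * ‖φ‖) * Real.exp (-a * ∑ x : Site P j, ‖φ x‖ ^ 2)) := by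
  have hg := (integrable_exp_neg_mul_sum_sq (P := P) (j := j) (N := N) (half_pos ha)).const_mul (Real.exp (κ ^ 2 / (2 * a)))
  refine hg.mono' ?_ (Filter.Eventually.of_forall fun φ => ?_)
  · exact ((continuous_const.mul continuous_norm).rexp.mul
      ((continuous_const.mul (continuous_finsetSum _ fun x _ => (continuous_apply x).norm.pow 2)).rexp)).aestronglyMeasurable
  · rw [Real.norm_eq_abs, abs_of_nonneg (mul_nonneg (Real.exp_pos _).le (Real.exp_pos _).le), ← Real.exp_add, ← Real.exp_add,
      Real.exp_le_exp]
    have hS := sq_norm_le_sum φ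
    have ha' : a ≠ 0 := ha.ne'
    have hkey : κ * ‖φ‖ ≤ a / 2 * ‖φ‖ ^ 2 + κ ^ 2 / (2 * a) := by
      have h0 : 0 ≤ a / 2 * (‖φ‖ - κ / a) ^ 2 := by positivity
      have h1 : a / 2 * (‖φ‖ - κ / a) ^ 2 = a / 2 * ‖φ‖ ^ 2 - κ * ‖φ‖ + κ ^ 2 / (2 * a) := by
        field_simp
        ring
      linarith
    nlinarith [mul_nonneg (half_pos ha).le (sub_nonneg.mpr hS)]

/-! ## §3 (2.24) for the lattice model -/

/-- **(2.24) p. 430 [PDF 20] for the concrete lattice model**, verbatim: *"Taking a first order differential with respect to λ we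
get: ∫dφ exp[−½⟨φ,(−Δ^η_A + M²)φ⟩]F(φ)⟨D^η_Aφ, ∂^ηλqφ⟩ = 0. (2.24)"* — for every background `A`, gauge function `λ`, and continuous
gauge-invariant `F` of exponential-linear growth (all gauge-invariant polynomials, e.g. the printed `−λ_kΣη^d:|φ(x)|⁴:`), with
`η^d = w > 0`, `M² > 0` and a charged coupling `cηe ≠ 0`.  The printed proof, formalized: `t ↦ ∫dφ e^{−½⟨φ,(−Δ_{A−t∂λ}+M²)φ⟩}F(φ)`
is constant by (2.23) (`B3WT223Instance.eq223`), differentiable at `t = 0` under the integral sign (dominated convergence with the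
Gaussian majorant of §2) with derivative `cηe·∫e^{…}F⟨D_Aφ,∂λqφ⟩` (`hasDerivAt_weight`), and a constant differentiable family has
derivative `0` (`B3Sect2StatementsPart2.deriv_eq_zero_of_invariant` BY NAME). [cite: Balaban1983Higgs3, (2.24) p.430] -/
theorem eq224 (hw : 0 < w) (hM : 0 < M2) (hce : c * η * C.e ≠ 0) (A : VecField P j ℝ) (lam : Site P j → ℝ)
    (F : Cfg P j N → ℝ) (hFinv : ∀ (lam' : Site P j → ℝ) (φ : Cfg P j N), F (rot C η c lam' φ) = F φ)
    (hFcont : Continuous F) (hFgr : ∃ K κ : ℝ, ∀ φ, |F φ| ≤ K * Real.exp (κ * ‖φ‖)) :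
    ∫ φ, weight C η w c M2 A φ * (F φ * pairDA C η w c A lam φ) = 0 := by
  obtain ⟨K, κ, hK⟩ := hFgr
  -- the family `G t = e^{−½⟨φ,(−Δ_{A−t∂λ}+M²)φ⟩}F(φ)` and its `t`-derivative `G'`
  set G : ℝ → Cfg P j N → ℝ := fun t φ => weight C η w c M2 (gaugeShift c (t • lam) A) φ * F φ with hG
  set G' : ℝ → Cfg P j N → ℝ := fun t φ =>
    (c * η * C.e) * (weight C η w c M2 (gaugeShift c (t • lam) A) φ * pairDA C η w c (gaugeShift c (t • lam) A) lam φ) * F φ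
    with hG'
  -- (2.23): the family of integrals is constant
  have hconst : ∀ t : ℝ, ∫ φ, G t φ = ∫ φ, G 0 φ := by
    intro t
    simp only [hG, gaugeShift_zero_smul]
    exact eq223 C η w c M2 (t • lam) A F (hFinv (t • lam))
  -- the Gaussian majorant `bound`, uniform for `t` in the unit ball
  set a : ℝ := M2 * w / 2 with ha_def
  have ha : 0 < a := by positivity
  set bound : Cfg P j N → ℝ := fun φ =>
    |c * η * C.e| * pairBound w c lam * K * (Real.exp ((κ + 2) * ‖φ‖) * Real.exp (-a * ∑ x : Site P j, ‖φ x‖ ^ 2)) with hbound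
  have hbound_int : Integrable bound := (integrable_explin_mul_gauss (κ + 2) ha).const_mul _
  have hsq_exp : ∀ φ : Cfg P j N, ‖φ‖ ^ 2 ≤ Real.exp (2 * ‖φ‖) := fun φ => by
    have h1 : ‖φ‖ ≤ Real.exp ‖φ‖ := by linarith [Real.add_one_le_exp ‖φ‖]
    calc ‖φ‖ ^ 2 ≤ Real.exp ‖φ‖ ^ 2 := pow_le_pow_left₀ (norm_nonneg _) h1 2
      _ = Real.exp (2 * ‖φ‖) := by rw [← Real.exp_nat_mul]; norm_num
  have hwt : ∀ (t : ℝ) (φ : Cfg P j N),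
      weight C η w c M2 (gaugeShift c (t • lam) A) φ ≤ Real.exp (-a * ∑ x : Site P j, ‖φ x‖ ^ 2) := fun t φ =>
    weight_le_gauss hw.le _ φ
  have h_bound : ∀ᵐ φ ∂(volume : Measure (Cfg P j N)), ∀ t ∈ Metric.ball (0 : ℝ) 1, ‖G' t φ‖ ≤ bound φ := by
    refine Filter.Eventually.of_forall fun φ t _ => ?_
    have e1 : Real.exp ((κ + 2) * ‖φ‖) = Real.exp (κ * ‖φ‖) * Real.exp (2 * ‖φ‖) := by
      rw [← Real.exp_add]
      ring_nf
    have e2 : ‖G' t φ‖ = |c * η * C.e| * (weight C η w c M2 (gaugeShift c (t • lam) A) φ *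
        |pairDA C η w c (gaugeShift c (t • lam) A) lam φ|) * |F φ| := by
      simp only [hG', Real.norm_eq_abs, abs_mul,
        abs_of_pos (weight_pos (C := C) (η := η) (w := w) (c := c) (M2 := M2) (gaugeShift c (t • lam) A) φ)]
    rw [e2]
    simp only [hbound]
    rw [e1]
    have h1 := hwt t φ
    have h2 := abs_pairDA_le C η w c (gaugeShift c (t • lam) A) lam φ
    have hpb := pairBound_nonneg w c lam
    calc |c * η * C.e| * (weight C η w c M2 (gaugeShift c (t • lam) A) φ * |pairDA C η w c (gaugeShift c (t • lam) A) lam φ|) * |F φ|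
        ≤ |c * η * C.e| * (Real.exp (-a * ∑ x : Site P j, ‖φ x‖ ^ 2) * (pairBound w c lam * Real.exp (2 * ‖φ‖))) *
            (K * Real.exp (κ * ‖φ‖)) := by
          refine mul_le_mul (mul_le_mul_of_nonneg_left ?_ (abs_nonneg _)) (hK φ) (abs_nonneg _) (by positivity)
          exact mul_le_mul h1 (h2.trans (mul_le_mul_of_nonneg_left (hsq_exp φ) hpb)) (abs_nonneg _) (Real.exp_pos _).le
      _ = |c * η * C.e| * pairBound w c lam * K *
            (Real.exp (κ * ‖φ‖) * Real.exp (2 * ‖φ‖) * Real.exp (-a * ∑ x : Site P j, ‖φ x‖ ^ 2)) := by ring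
  have h_diff : ∀ᵐ φ ∂(volume : Measure (Cfg P j N)), ∀ t ∈ Metric.ball (0 : ℝ) 1, HasDerivAt (G · φ) (G' t φ) t := by
    refine Filter.Eventually.of_forall fun φ t _ => ?_
    simp only [hG, hG']
    exact (hasDerivAt_weight C η w c M2 lam A φ t).mul_const (F φ)
  have hG_meas : ∀ t : ℝ, AEStronglyMeasurable (G t) (volume : Measure (Cfg P j N)) := fun t =>
    ((continuous_weight C η w c M2 _).mul hFcont).aestronglyMeasurable
  have hG'_meas : AEStronglyMeasurable (G' 0) (volume : Measure (Cfg P j N)) :=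
    ((continuous_const.mul ((continuous_weight C η w c M2 _).mul (continuous_pairDA C η w c _ lam))).mul hFcont).aestronglyMeasurable
  have hG_int : Integrable (G 0) (volume : Measure (Cfg P j N)) := by
    refine ((integrable_explin_mul_gauss (P := P) (j := j) (N := N) κ ha).const_mul K).mono' (hG_meas 0)
      (Filter.Eventually.of_forall fun φ => ?_)
    have e3 : ‖G 0 φ‖ = weight C η w c M2 (gaugeShift c ((0 : ℝ) • lam) A) φ * |F φ| := by
      simp only [hG, Real.norm_eq_abs, abs_mul,
        abs_of_pos (weight_pos (C := C) (η := η) (w := w) (c := c) (M2 := M2) (gaugeShift c ((0 : ℝ) • lam) A) φ)]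
    rw [e3]
    calc weight C η w c M2 (gaugeShift c ((0 : ℝ) • lam) A) φ * |F φ|
        ≤ Real.exp (-a * ∑ x : Site P j, ‖φ x‖ ^ 2) * (K * Real.exp (κ * ‖φ‖)) :=
          mul_le_mul (hwt 0 φ) (hK φ) (abs_nonneg _) (Real.exp_pos _).le
      _ = K * (Real.exp (κ * ‖φ‖) * Real.exp (-a * ∑ x : Site P j, ‖φ x‖ ^ 2)) := by ring
  -- differentiation under the integral sign, and `f' = 0` for the constant family
  have hD := (hasDerivAt_integral_of_dominated_loc_of_deriv_le (Metric.ball_mem_nhds (0 : ℝ) one_pos)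
    (Filter.Eventually.of_forall hG_meas) hG_int hG'_meas h_bound hbound_int h_diff).2
  have hzero := B3Sect2StatementsPart2.deriv_eq_zero_of_invariant hconst hD
  have hint : ∫ φ, G' 0 φ = (c * η * C.e) * ∫ φ, weight C η w c M2 A φ * (F φ * pairDA C η w c A lam φ) := by
    rw [← integral_const_mul]
    refine integral_congr_ae (Filter.Eventually.of_forall fun φ => ?_)
    simp only [hG', gaugeShift_zero_smul]
    ring
  rw [hint] at hzero
  exact (mul_eq_zero.mp hzero).resolve_left hce

/-! ## §4 The concrete `WTData`; rows B3.Eq2.24 / B3.Eq2.25 discharged -/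

/-- at `A = 0` the pairing of (2.24) is the pairing of (2.25): `⟨D^η_0φ, ∂^ηλqφ⟩ = ⟨∂^ηφ, ∂^ηλqφ⟩` (`U(0) = 1`, `D_0 = ∂`, B1 (1.7)).
[cite: Balaban1983Higgs3, (2.25) p.431] -/
theorem pairDA_zero (lam : Site P j → ℝ) (φ : Cfg P j N) : pairDA C η w c (0 : VecField P j ℝ) lam φ = pairD C w c lam φ := by
  unfold pairDA pairD
  refine Finset.sum_congr rfl fun b _ => ?_
  have h0 : covDerivScalar c (C.Urep η) (0 : VecField P j ℝ) φ = grad c φ := covDerivScalar_Urep_zero C η c φ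
  rw [h0, Pi.zero_apply, HiggsLattice.ChargeData.U_zero]
  rfl

/-- **The Ward–Takahashi datum of the `(Higgs)₂,₃` lattice model**, an instance of r15's abstract carrier `B3Sect2StatementsPart2.WTData`
(rows B3.Eq2.24/B3.Eq2.25): `Field` = `φ : T^{(j)} → R^N` (Lebesgue `dφ`), `GaugeFn` = `λ : T^{(j)} → R`, `InvFn` = continuous `F` with
`F(φ^λ) = F(φ)` for all `λ` and `|F(φ)| ≤ Ke^{κ sup|φ|}` (*"F(φ) is an arbitrary gauge-invariant function … chosen as a polynomial"*),
`gaussA F = ∫dφ e^{−½⟨φ,(−Δ^η_A+M²)φ⟩}F(φ)` in the background `A`, `meanC F = ∫dμ_{C^η_{M²}}(φ)F(φ)` (normalized, `A = 0`),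
`pairDA`/`pairD` the printed pairings; parameters `C = (e, q)` of B1 (1.7), spacing `η`, weight `w = η^d`, `c = η⁻¹`, `M²`.
[cite: Balaban1983Higgs3, (2.24) p.430] -/
def wtModel (A : VecField P j ℝ) : B3Sect2StatementsPart2.WTData where
  Field := Cfg P j N
  GaugeFn := Site P j → ℝ
  InvFn := {F : Cfg P j N → ℝ //
    (∀ (lam : Site P j → ℝ) (φ : Cfg P j N), F (rot C η c lam φ) = F φ) ∧ Continuous F ∧
      ∃ K κ : ℝ, ∀ φ, |F φ| ≤ K * Real.exp (κ * ‖φ‖)}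
  evalF := fun F φ => F.1 φ
  gaussA := fun G => ∫ φ, weight C η w c M2 A φ * G φ
  meanC := fun G => (∫ φ, weight C η w c M2 (0 : VecField P j ℝ) φ * G φ) / ∫ φ, weight C η w c M2 (0 : VecField P j ℝ) φ
  pairDA := fun lam φ => pairDA C η w c A lam φ
  pairD := fun lam φ => pairD C w c lam φ

/-- **Row B3.Eq2.24 DISCHARGED for the lattice model**: `WTData.Eq224` holds for `wtModel` (charged coupling `cηe ≠ 0`, `η^d > 0`,
`M² > 0`, every background `A`). [cite: Balaban1983Higgs3, (2.24) p.430] -/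
theorem eq224_holds (hw : 0 < w) (hM : 0 < M2) (hce : c * η * C.e ≠ 0) (A : VecField P j ℝ) :
    B3Sect2StatementsPart2.Eq224 (wtModel C η w c M2 A) := fun F lam =>
  eq224 C η w c M2 hw hM hce A lam F.1 F.2.1 F.2.2.1 F.2.2.2

/-- *"Taking F = 1"*: the constant `1` is an admissible gauge-invariant function of the model. [cite: Balaban1983Higgs3, (2.25) p.431] -/
def oneInv (A : VecField P j ℝ) : (wtModel C η w c M2 A).InvFn :=
  ⟨fun _ => 1, fun _ _ => rfl, continuous_const, 1, 0, fun _ => by simp⟩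

/-- **Row B3.Eq2.25 DISCHARGED for the lattice model** by the printed route *"Taking F = 1, A = 0, we get
∫dμ_{C^η_{M²}}(φ)⟨∂^ηφ, ∂^ηλqφ⟩ = 0. (2.25)"*: `WTData.Eq225` holds for `wtModel`. [cite: Balaban1983Higgs3, (2.25) p.431] -/
theorem eq225_holds (hw : 0 < w) (hM : 0 < M2) (hce : c * η * C.e ≠ 0) (A : VecField P j ℝ) :
    B3Sect2StatementsPart2.Eq225 (wtModel C η w c M2 A) := by
  intro lam
  change (∫ φ, weight C η w c M2 (0 : VecField P j ℝ) φ * pairD C w c lam φ) /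
      ∫ φ, weight C η w c M2 (0 : VecField P j ℝ) φ = 0
  have h := eq224 C η w c M2 hw hM hce (0 : VecField P j ℝ) lam (fun _ => (1 : ℝ)) (fun _ _ => rfl) continuous_const
    ⟨1, 0, fun _ => by simp⟩
  simp only [one_mul, pairDA_zero] at h
  rw [h, zero_div]

/-- (2.25) as an unnormalized Gaussian integral, in the printed order: `∫dφ exp[−½⟨φ,(−Δ^η+M²)φ⟩]⟨∂^ηφ, ∂^ηλqφ⟩ = 0`.
[cite: Balaban1983Higgs3, (2.25) p.431] -/
theorem eq225 (hw : 0 < w) (hM : 0 < M2) (hce : c * η * C.e ≠ 0) (lam : Site P j → ℝ) :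
    ∫ φ, weight C η w c M2 (0 : VecField P j ℝ) φ * pairD C w c lam φ = 0 := by
  have h := eq224 C η w c M2 hw hM hce (0 : VecField P j ℝ) lam (fun _ => (1 : ℝ)) (fun _ _ => rfl) continuous_const
    ⟨1, 0, fun _ => by simp⟩
  simpa only [one_mul, pairDA_zero] using h

end Literature.MathematicalPhysics.QuantumFieldTheory.Balaban1983to89.B3WT224Instance

end
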